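import Literature.AlgebraicGeometry.GroupSchemes.GeneralLinearGroupActionOnChartPoints
import HarnessLib

/-!
# The frame locus of `n + 2` points of `𝐏ⁿ` is invariant under the action of `GL_{n+1}(Γ(T, 𝒪_T))`

Topic `Literature/AlgebraicGeometry/Morphisms`; namespaces `Literature.AlgebraicGeometry.ProjectiveSpace.ProjFrame`
(§ 1, ring level) and `Literature.AlgebraicGeometry.Morphisms.ProjFrame` (§§ 2–4).  THEOREMS ONLY (no definition, no
named fact, no instance, no `sorry`, no local instance attribute; `set_option backward.isDefEq.respectTransparency false`
as in the tree's action files).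

Mumford–Fogarty–Kirwan Ch. 3 §1 (p. 68): for an `R`-partition the open set `U_R ⊂ (P_n)^{m}` «(i) `D_{0,…,n} ≠ 0`,
(ii) `D_{0,…,î,…,n,n+1} ≠ 0`» is **`PGL(n+1)`-INVARIANT** — the determinants `D_{α₀…α_n} = det [X_i^{(α_j)}]` are
multiplied by `det g` (and by units under rescaling of homogeneous coordinates), Prop. 3.1: «`U_R` is a
`PGL(n+1)`-stable open set».  Hartshorne II Example 7.1.1 (p. 151): an invertible matrix acts on `𝐏ⁿ` by
`x_i' = Σ_j a_{ij} x_j`.  Görtz–Wedhorn Def. 4.44 (p. 117): the action read on `T`-valued points.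

In the tree: the frame locus `ProjFrame.frameLocus φ : T.Opens` of a tuple `φ : Fin (n+2) → (T ⟶ 𝐏ⁿ_ℤ)`
(`Morphisms/ProjectiveFrameLocus`, with base change `preimage_frameLocus` and the fibrewise reading
`mem_frameLocus_iff_fromSpecResidueField`), the action core `actCore I M : Proj Γ[x] ⟶ 𝐏ⁿ_ℤ` of
`M ∈ GL_{n+1}(Γ(T, 𝒪_T))` with its point-level laws (`GroupSchemes/GeneralLinearGroupActionUniversalPoint`), and the
action on chart coordinates (`GroupSchemes/GeneralLinearGroupActionOnChartPoints`).  Here: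

* § 1 ring level: **`IsUnitFrame.mulVec`** — a unit frame stays a unit frame under `P_j ↦ M P_j`, `M ∈ GL_{n+1}(A)`
  (`minor (M P) l = M · minor P l`, `det` multiplicative; with `IsUnitFrame.rowScale` for units);
* § 2 the acted `T`-point `M • q := ⟨T → Spec Γ(T,𝒪_T), q⟩ ≫ actCore I M` (brick A pairing, then the core):
  **`comp_lift_actCore`** — its formation commutes with base change `x : T' → T` (the matrix becomes `x^* M`);
  **`lift_actCore_eq_coordPoint`** — the one-chart formula `M • [θ] = [M θ]` (the `S`-free twin of
  `lift_act_left_snd_eq_coordPoint`), with `preU` / `topCoord` corollaries for tuples;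
* § 3 over a one-point base whose global functions form a field-like ring (every non-zero element a unit —
  `Spec` of a residue field): `frameLocus (M • ψ) = ⊤` if `frameLocus ψ = ⊤` (a unimodular vector has a unit
  coordinate, so the chart hypotheses of § 2 hold);
* § 4 **`frameLocus_lift_actCore : frameLocus (fun j => M • φ j) = frameLocus φ`** for every scheme `T`, every
  tuple and every `M ∈ GL_{n+1}(Γ(T, 𝒪_T))` — fibrewise by § 3, using § 2's base change and the action laws
  `M⁻¹ • (M • q) = q`.

Cell `hodgecm-mathlib` (D-0151), F-8 REOPENED (director s231), path (8β) «the open sub-functors `𝓕_R`», generic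
half (8β-a): the frame condition on marked points read through a linear rigidification does not depend on the
rigidification.  COUNT-NEUTRAL capital: HC_CM is proved only modulo the 7 printed citations until rung 0 closes;
this file discharges none of them.

## References
* [MumfordFogartyKirwan1994] D. Mumford, J. Fogarty, F. Kirwan, *Geometric Invariant Theory*, 3rd ed. (1994):
  Ch. 3 §1, Definition 3.3 and Proposition 3.1 (pp. 68–69).
* [Hartshorne1977] R. Hartshorne, *Algebraic Geometry* (1977): II Example 7.1.1 (p. 151).
* [GortzWedhorn2020] U. Görtz, T. Wedhorn, *Algebraic Geometry I: Schemes*, 2nd ed. (2020): Definition 4.44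
  (p. 117), Section (4.12) (p. 113).
-/

noncomputable section

-- Mathlib's pull-back / product API is stated through `abbrev`s over `limit`; as in Mathlib's own algebraic-geometry
-- files and the tree's action files we let `simp`/unification see through them.
set_option backward.isDefEq.respectTransparency false

universe u

open CategoryTheory CategoryTheory.Limits AlgebraicGeometry Matrix HomogeneousLocalization TopologicalSpace
open MvPolynomial (X)
open Literature.AlgebraicGeometry.Morphisms (intU projectiveSpaceInt isPullback_projToSpec_projMap_terminal)
open Literature.AlgebraicGeometry.Motives.ProjBaseChangeRing (mapGraded irrelevant_le_map projToSpec)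
open Literature.AlgebraicGeometry.Motives.GeneratingSections
open Literature.AlgebraicGeometry.GroupSchemes.GeneralLinearGroupScheme (intCast actCore actCore_def
  lift_comp_projMap_mapGraded projMap_mapGraded_comp_actCore lift_comp_actCore_one lift_comp_actCore_mul
  eq_coordPoint_int lift_toSpecΓ_coordPoint)
open Literature.AlgebraicGeometry.GroupSchemes.ProjLinAction (projLinAut vecPoint vecPoint_comp_projLinAut)


/-! ## § 1 Ring level: unit frames are stable under `GL_{n+1}(A)` -/

namespace Literature.AlgebraicGeometry.ProjectiveSpace.ProjFrame

variable {A : Type u} [CommRing A] {d : ℕ}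

/-- The maximal minors of the moved tuple: `minor (M P) l = M · minor P l` (the columns of `minor P l` are the
vectors `P_j`, `j ≠ l`). [cite: MumfordFogartyKirwan1994, Ch. 3 Definition 3.3] -/
theorem minor_mulVec (M : Matrix (Fin (d + 1)) (Fin (d + 1)) A) (P : Fin (d + 2) → Fin (d + 1) → A)
    (l : Fin (d + 2)) : minor (fun j => M *ᵥ P j) l = M * minor P l := by
  ext i k
  simp only [minor_apply, Matrix.mul_apply, Matrix.mulVec, dotProduct]

/-- **A unit frame stays a unit frame under an invertible matrix**: `IsUnitFrame P → IsUnitFrame (M P_j)_j` for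
`M ∈ GL_{n+1}(A)` — MFK's determinants `D_S` are multiplied by `det M` («`U_R` is `PGL(n+1)`-stable», Prop. 3.1).
[cite: MumfordFogartyKirwan1994, Ch. 3 Proposition 3.1] -/
theorem IsUnitFrame.mulVec {P : Fin (d + 2) → Fin (d + 1) → A} (hP : IsUnitFrame P) (M : GL (Fin (d + 1)) A) :
    IsUnitFrame fun j => (M : Matrix (Fin (d + 1)) (Fin (d + 1)) A) *ᵥ P j := by
  rw [isUnitFrame_iff_forall_isUnit_det_minor] at hP ⊢
  intro l
  rw [minor_mulVec, Matrix.det_mul]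
  have hM : IsUnit (M : Matrix (Fin (d + 1)) (Fin (d + 1)) A).det := by
    rw [← Matrix.GeneralLinearGroup.val_det_apply]
    exact Units.isUnit _
  exact hM.mul (hP l)

/-- … and under an invertible matrix followed by unit rescalings of the vectors (homogeneous coordinates are
read up to units). [cite: MumfordFogartyKirwan1994, Ch. 3 Proposition 3.1] -/
theorem IsUnitFrame.mulVec_mul {P : Fin (d + 2) → Fin (d + 1) → A} (hP : IsUnitFrame P)
    (M : GL (Fin (d + 1)) A) {w : Fin (d + 2) → A} (hw : ∀ j, IsUnit (w j)) :
    IsUnitFrame fun j i => ((M : Matrix (Fin (d + 1)) (Fin (d + 1)) A) *ᵥ P j) i * w j := by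
  have h := (hP.mulVec M).rowScale hw
  have e : (fun j i => ((M : Matrix (Fin (d + 1)) (Fin (d + 1)) A) *ᵥ P j) i * w j) =
      fun j i => w j * ((M : Matrix (Fin (d + 1)) (Fin (d + 1)) A) *ᵥ P j) i :=
    funext fun j => funext fun i => mul_comm _ _
  rw [e]
  exact h

/-- Over a ring in which every non-zero element is a unit (a field, or its image under a ring isomorphism),
a vector with a unit coordinate keeps SOME unit coordinate under an invertible matrix.
[cite: GortzWedhorn2020, Definition 4.44 (p. 117)] -/
theorem exists_isUnit_mulVec_apply (hA : ∀ v : A, v ≠ 0 → IsUnit v) (M : GL (Fin (d + 1)) A)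
    (θ : Fin (d + 1) → A) {a : Fin (d + 1)} (ha : IsUnit (θ a)) :
    ∃ b, IsUnit (((M : Matrix (Fin (d + 1)) (Fin (d + 1)) A) *ᵥ θ) b) := by
  by_contra h
  simp only [not_exists] at h
  have h0 : (M : Matrix (Fin (d + 1)) (Fin (d + 1)) A) *ᵥ θ = 0 := by
    funext b
    by_contra hb
    exact h b (hA _ hb)
  have hθ : θ = 0 := by
    have e : ((M⁻¹ : GL (Fin (d + 1)) A) : Matrix (Fin (d + 1)) (Fin (d + 1)) A) *ᵥ
        ((M : Matrix (Fin (d + 1)) (Fin (d + 1)) A) *ᵥ θ) = θ := by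
      rw [Matrix.mulVec_mulVec, ← Matrix.GeneralLinearGroup.coe_mul, inv_mul_cancel,
        Matrix.GeneralLinearGroup.coe_one, Matrix.one_mulVec]
    rw [← e, h0, Matrix.mulVec_zero]
  have h1 : IsUnit (0 : A) := by
    have : θ a = 0 := by rw [hθ]; rfl
    rwa [this] at ha
  haveI := subsingleton_of_zero_eq_one (isUnit_zero_iff.mp h1)
  exact h a (isUnit_of_subsingleton _)

end Literature.AlgebraicGeometry.ProjectiveSpace.ProjFrame

/-! ## § 2 The acted `T`-point `M • q` and its base change; the one-chart formula -/

namespace Literature.AlgebraicGeometry.Morphisms.ProjFrame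

open Literature.AlgebraicGeometry.ProjectiveSpace.ProjFrame (IsUnitFrame IsUnitFrame.mulVec_mul
  exists_isUnit_mulVec_apply)

variable (I : Type u) {T : Scheme.{u}}

/-- **Base change of the acted point**: for `x : T' → T`, `q : T → 𝐏ⁿ_ℤ` and `M ∈ GL_{n+1}(Γ(T, 𝒪_T))`,
`x ≫ (M • q) = (x^*M) • (x ≫ q)`, where `M • q` is brick A's pairing `⟨T → Spec Γ(T, 𝒪_T), q⟩ : T → Proj Γ(T,𝒪_T)[x]`
followed by the core `actCore I M` (Görtz–Wedhorn Def. 4.44: `a(T)` is natural in `T`; the tree's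
`lift_comp_projMap_mapGraded` and `projMap_mapGraded_comp_actCore`). [cite: GortzWedhorn2020, Definition 4.44 (p. 117)] -/
@[reassoc]
theorem comp_lift_actCore {T' : Scheme.{u}} (x : T' ⟶ T) (q : T ⟶ projectiveSpaceInt I)
    (M : GL (Fin (Nat.card I + 1)) Γ(T, ⊤)) :
    letI : Algebra intU.{u} Γ(T, ⊤) := (intCast _).toAlgebra
    letI : Algebra intU.{u} Γ(T', ⊤) := (intCast _).toAlgebra
    x ≫ ((isPullback_projToSpec_projMap_terminal I Γ(T, ⊤)).lift T.toSpecΓ q (terminal.hom_ext _ _) ≫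
        actCore I M) =
      (isPullback_projToSpec_projMap_terminal I Γ(T', ⊤)).lift T'.toSpecΓ (x ≫ q) (terminal.hom_ext _ _) ≫
        actCore I (Matrix.GeneralLinearGroup.map x.appTop.hom M) := by
  letI : Algebra intU.{u} Γ(T, ⊤) := (intCast _).toAlgebra
  letI : Algebra intU.{u} Γ(T', ⊤) := (intCast _).toAlgebra
  letI : Algebra Γ(T, ⊤) Γ(T', ⊤) := x.appTop.hom.toAlgebra
  have h1 : x ≫ (isPullback_projToSpec_projMap_terminal I Γ(T, ⊤)).lift T.toSpecΓ q (terminal.hom_ext _ _) =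
      (isPullback_projToSpec_projMap_terminal I Γ(T, ⊤)).lift
        (T'.toSpecΓ ≫ Spec.map (CommRingCat.ofHom (algebraMap Γ(T, ⊤) Γ(T', ⊤)))) (x ≫ q)
        (terminal.hom_ext _ _) := by
    apply (isPullback_projToSpec_projMap_terminal I Γ(T, ⊤)).hom_ext
    · rw [Category.assoc, IsPullback.lift_fst, IsPullback.lift_fst, Scheme.toSpecΓ_naturality]
      rfl
    · rw [Category.assoc, IsPullback.lift_snd, IsPullback.lift_snd]
  rw [← Category.assoc, h1, ← lift_comp_projMap_mapGraded (I := I) (B := Γ(T, ⊤)) (B' := Γ(T', ⊤)) T'.toSpecΓ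
      (x ≫ q), Category.assoc, projMap_mapGraded_comp_actCore]
  rfl

/-- **The action laws undo each other on points: `M⁻¹ • (M • q) = q`** (`lift_comp_actCore_mul`,
`lift_comp_actCore_one`). [cite: GortzWedhorn2020, Definition 4.44 (p. 117)] -/
theorem lift_lift_actCore_inv (q : T ⟶ projectiveSpaceInt I) (M : GL (Fin (Nat.card I + 1)) Γ(T, ⊤)) :
    letI : Algebra intU.{u} Γ(T, ⊤) := (intCast _).toAlgebra
    (isPullback_projToSpec_projMap_terminal I Γ(T, ⊤)).lift T.toSpecΓ
        ((isPullback_projToSpec_projMap_terminal I Γ(T, ⊤)).lift T.toSpecΓ q (terminal.hom_ext _ _) ≫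
          actCore I M) (terminal.hom_ext _ _) ≫ actCore I M⁻¹ = q := by
  letI : Algebra intU.{u} Γ(T, ⊤) := (intCast _).toAlgebra
  rw [← lift_comp_actCore_mul, inv_mul_cancel, lift_comp_actCore_one]

/-- **THE ACTION ON `T`-VALUED POINTS, ONE CHART, `S`-free form**: if `q : T → 𝐏ⁿ_ℤ` lands in `D₊(x_a)` with
coordinate vector `θ` and `(M θ)_b` is a unit, then `M • q = coordPoint (M θ) b` («the point with the transformed
homogeneous coordinates»; the `S`-free twin of `lift_act_left_snd_eq_coordPoint`).
[cite: Hartshorne1977, II Example 7.1.1 (p. 151)] -/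
theorem lift_actCore_eq_coordPoint (q : T ⟶ projectiveSpaceInt I) (M : GL (Fin (Nat.card I + 1)) Γ(T, ⊤))
    (a b : Fin (Nat.card I + 1)) (θ : Fin (Nat.card I + 1) → Γ(T, ⊤)) (ha : preU q a = ⊤)
    (hθq : ∀ i, rs ha.ge (homRatio q a i) = θ i) (hθ : IsUnit (θ a))
    (hb : IsUnit (((M : Matrix _ _ Γ(T, ⊤)) *ᵥ θ) b)) :
    letI : Algebra intU.{u} Γ(T, ⊤) := (intCast _).toAlgebra
    (isPullback_projToSpec_projMap_terminal I Γ(T, ⊤)).lift T.toSpecΓ q (terminal.hom_ext _ _) ≫ actCore I M =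
      coordPoint intU.{u} ((M : Matrix _ _ Γ(T, ⊤)) *ᵥ θ) b hb := by
  letI : Algebra intU.{u} Γ(T, ⊤) := (intCast _).toAlgebra
  have ha' : IsUnit (MvPolynomial.eval θ (X a)) := by rwa [MvPolynomial.eval_X]
  have hb' : IsUnit (MvPolynomial.eval ((M : Matrix _ _ Γ(T, ⊤)) *ᵥ θ) (X b)) := by
    rwa [MvPolynomial.eval_X]
  rw [lift_toSpecΓ_coordPoint I q θ a hθ (eq_coordPoint_int I q a ha θ hθq hθ) ha', actCore_def,
    Category.assoc, ← Category.assoc (vecPoint θ _ _ _) (projLinAut _).hom,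
    vecPoint_comp_projLinAut M θ a b ha' hb', toSpecΓ_comp_vecPoint_comp_projMap _ b hb]

/-- Hence `M • q` lands in `D₊(x_b)` … [cite: Hartshorne1977, II Example 7.1.1 (p. 151)] -/
theorem preU_lift_actCore (q : T ⟶ projectiveSpaceInt I) (M : GL (Fin (Nat.card I + 1)) Γ(T, ⊤))
    (a b : Fin (Nat.card I + 1)) (θ : Fin (Nat.card I + 1) → Γ(T, ⊤)) (ha : preU q a = ⊤)
    (hθq : ∀ i, rs ha.ge (homRatio q a i) = θ i) (hθ : IsUnit (θ a))
    (hb : IsUnit (((M : Matrix _ _ Γ(T, ⊤)) *ᵥ θ) b)) :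
    letI : Algebra intU.{u} Γ(T, ⊤) := (intCast _).toAlgebra
    preU ((isPullback_projToSpec_projMap_terminal I Γ(T, ⊤)).lift T.toSpecΓ q (terminal.hom_ext _ _) ≫
      actCore I M) b = ⊤ := by
  letI : Algebra intU.{u} Γ(T, ⊤) := (intCast _).toAlgebra
  rw [lift_actCore_eq_coordPoint I q M a b θ ha hθq hθ hb]
  exact preU_coordPoint _ b hb

/-- If two morphisms to `ℙ(ι)_k` are equal, their chart coordinates read on `T` agree (transport of the
proof-dependent restriction). [folklore] -/
private theorem rs_homRatio_congr' {q q' : T ⟶ projectiveSpaceInt I} (e : q = q') {a : Fin (Nat.card I + 1)}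
    (ha : preU q a = ⊤) (ha' : preU q' a = ⊤) (i : Fin (Nat.card I + 1)) :
    rs ha.ge (homRatio q a i) = rs ha'.ge (homRatio q' a i) := by
  subst e
  rfl

/-- … with chart coordinates `(M θ)ᵢ (M θ)_b⁻¹`. [cite: Hartshorne1977, II Example 7.1.1 (p. 151)] -/
theorem rs_homRatio_lift_actCore (q : T ⟶ projectiveSpaceInt I) (M : GL (Fin (Nat.card I + 1)) Γ(T, ⊤))
    (a b : Fin (Nat.card I + 1)) (θ : Fin (Nat.card I + 1) → Γ(T, ⊤)) (ha : preU q a = ⊤)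
    (hθq : ∀ i, rs ha.ge (homRatio q a i) = θ i) (hθ : IsUnit (θ a))
    (hb : IsUnit (((M : Matrix _ _ Γ(T, ⊤)) *ᵥ θ) b)) (i : Fin (Nat.card I + 1)) :
    letI : Algebra intU.{u} Γ(T, ⊤) := (intCast _).toAlgebra
    rs (preU_lift_actCore I q M a b θ ha hθq hθ hb).ge
        (homRatio ((isPullback_projToSpec_projMap_terminal I Γ(T, ⊤)).lift T.toSpecΓ q (terminal.hom_ext _ _) ≫
          actCore I M) b i) =
      ((M : Matrix _ _ Γ(T, ⊤)) *ᵥ θ) i * ((hb.unit⁻¹ : (Γ(T, ⊤))ˣ) : Γ(T, ⊤)) := by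
  letI : Algebra intU.{u} Γ(T, ⊤) := (intCast _).toAlgebra
  rw [rs_homRatio_congr' I (lift_actCore_eq_coordPoint I q M a b θ ha hθq hθ hb)
    (preU_lift_actCore I q M a b θ ha hθq hθ hb) (preU_coordPoint _ b hb)]
  exact rs_homRatio_coordPoint _ b hb i

/-- **Tuples read in chart choices, charts**: if the points `φ j` land in `D₊(x_{c j})` with global coordinate
vectors `θ_j = topCoord φ c hc j` and `(M θ_j)_{c' j}` are units, the acted points `M • φ j` land in `D₊(x_{c' j})` …
[cite: GortzWedhorn2020, Definition 4.44 (p. 117)] -/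
theorem preU_lift_actCore_tuple (φ : Fin (Nat.card I + 2) → (T ⟶ projectiveSpaceInt I))
    (M : GL (Fin (Nat.card I + 1)) Γ(T, ⊤)) (c c' : Fin (Nat.card I + 2) → Fin (Nat.card I + 1))
    (hc : ∀ j, preU (φ j) (c j) = ⊤)
    (hb : ∀ j, IsUnit (((M : Matrix _ _ Γ(T, ⊤)) *ᵥ topCoord φ c hc j) (c' j))) (j : Fin (Nat.card I + 2)) :
    letI : Algebra intU.{u} Γ(T, ⊤) := (intCast _).toAlgebra
    preU ((isPullback_projToSpec_projMap_terminal I Γ(T, ⊤)).lift T.toSpecΓ (φ j) (terminal.hom_ext _ _) ≫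
      actCore I M) (c' j) = ⊤ :=
  preU_lift_actCore I (φ j) M (c j) (c' j) (topCoord φ c hc j) (hc j) (fun _ => rfl)
    (topCoord_self φ c hc j ▸ isUnit_one) (hb j)

/-- … **and the global coordinates of the acted tuple are the vectors `M θ_j` normalised at `c' j`**:
`topCoord (M • φ) c' _ j i = (M θ_j)ᵢ · ((M θ_j)_{c' j})⁻¹`. [cite: Hartshorne1977, II Example 7.1.1 (p. 151)] -/
theorem topCoord_lift_actCore (φ : Fin (Nat.card I + 2) → (T ⟶ projectiveSpaceInt I))
    (M : GL (Fin (Nat.card I + 1)) Γ(T, ⊤)) (c c' : Fin (Nat.card I + 2) → Fin (Nat.card I + 1))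
    (hc : ∀ j, preU (φ j) (c j) = ⊤)
    (hb : ∀ j, IsUnit (((M : Matrix _ _ Γ(T, ⊤)) *ᵥ topCoord φ c hc j) (c' j))) (j : Fin (Nat.card I + 2))
    (i : Fin (Nat.card I + 1)) :
    letI : Algebra intU.{u} Γ(T, ⊤) := (intCast _).toAlgebra
    topCoord (fun j => (isPullback_projToSpec_projMap_terminal I Γ(T, ⊤)).lift T.toSpecΓ (φ j)
        (terminal.hom_ext _ _) ≫ actCore I M) c' (preU_lift_actCore_tuple I φ M c c' hc hb) j i =
      ((M : Matrix _ _ Γ(T, ⊤)) *ᵥ topCoord φ c hc j) i * (((hb j).unit⁻¹ : (Γ(T, ⊤))ˣ) : Γ(T, ⊤)) :=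
  rs_homRatio_lift_actCore I (φ j) M (c j) (c' j) (topCoord φ c hc j) (hc j) (fun _ => rfl)
    (topCoord_self φ c hc j ▸ isUnit_one) (hb j) i

/-! ## § 3 Over a one-point base with field-like global functions -/

/-- **Over a one-point scheme whose ring of global functions has every non-zero element a unit** (e.g. `Spec` of a
residue field), **`frameLocus ψ = ⊤` implies `frameLocus (M • ψ) = ⊤`**: in some chart choice the coordinate
vectors form a unit frame (`frameLocus_eq_top_iff_exists_isUnitFrame_of_subsingleton`), each `M θ_j` has a unit
coordinate (`exists_isUnit_mulVec_apply`), so § 2 reads the acted tuple in a chart choice with coordinates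
`M θ_j` up to units — again a unit frame (`IsUnitFrame.mulVec_mul`). [cite: MumfordFogartyKirwan1994, Ch. 3 Proposition 3.1] -/
theorem frameLocus_lift_actCore_eq_top {Y : Scheme.{u}} [Subsingleton Y]
    (hY : ∀ v : Γ(Y, ⊤), v ≠ 0 → IsUnit v) (ψ : Fin (Nat.card I + 2) → (Y ⟶ projectiveSpaceInt I))
    (M : GL (Fin (Nat.card I + 1)) Γ(Y, ⊤)) (h : frameLocus ψ = ⊤) :
    letI : Algebra intU.{u} Γ(Y, ⊤) := (intCast _).toAlgebra
    frameLocus (fun j => (isPullback_projToSpec_projMap_terminal I Γ(Y, ⊤)).lift Y.toSpecΓ (ψ j)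
      (terminal.hom_ext _ _) ≫ actCore I M) = ⊤ := by
  letI : Algebra intU.{u} Γ(Y, ⊤) := (intCast _).toAlgebra
  obtain ⟨c, hc⟩ := exists_chart_eq_top_of_subsingleton ψ
  have hP : IsUnitFrame (topCoord ψ c hc) := (frameLocus_eq_top_iff_isUnitFrame ψ c hc).mp h
  choose c' hb using fun j =>
    exists_isUnit_mulVec_apply hY M (topCoord ψ c hc j) (topCoord_self ψ c hc j ▸ isUnit_one)
  rw [frameLocus_eq_top_iff_isUnitFrame _ c' (preU_lift_actCore_tuple I ψ M c c' hc hb)]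
  have e : topCoord (fun j => (isPullback_projToSpec_projMap_terminal I Γ(Y, ⊤)).lift Y.toSpecΓ (ψ j)
      (terminal.hom_ext _ _) ≫ actCore I M) c' (preU_lift_actCore_tuple I ψ M c c' hc hb) =
      fun j i => ((M : Matrix _ _ Γ(Y, ⊤)) *ᵥ topCoord ψ c hc j) i *
        (((hb j).unit⁻¹ : (Γ(Y, ⊤))ˣ) : Γ(Y, ⊤)) :=
    funext fun j => funext fun i => topCoord_lift_actCore I ψ M c c' hc hb j i
  rw [e]
  exact IsUnitFrame.mulVec_mul hP M fun j => Units.isUnit _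

/-- The global functions of `Spec` of a residue field are field-like: every non-zero element is a unit
(Mathlib `Scheme.ΓSpecIso`). [folklore] -/
private theorem isUnit_of_ne_zero_ΓSpec_residueField (t : T) (v : Γ(Spec (T.residueField t), ⊤))
    (hv : v ≠ 0) : IsUnit v := by
  let e : Γ(Spec (T.residueField t), ⊤) ≃+* T.residueField t :=
    (Scheme.ΓSpecIso (T.residueField t)).commRingCatIsoToRingEquiv
  rw [← MulEquiv.isUnit_map e, isUnit_iff_ne_zero]
  exact e.map_ne_zero_iff.mpr hv

/-! ## § 4 The frame locus is `GL_{n+1}(Γ(T, 𝒪_T))`-invariant -/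

/-- One inclusion, for every `T`: `frameLocus φ ≤ frameLocus (M • φ)` — fibrewise (`mem_frameLocus_iff_fromSpecResidueField`),
by base change of the acted points to the residue field (§ 2) and § 3 there. [cite: MumfordFogartyKirwan1994, Ch. 3 Proposition 3.1] -/
theorem frameLocus_le_frameLocus_lift_actCore (φ : Fin (Nat.card I + 2) → (T ⟶ projectiveSpaceInt I))
    (M : GL (Fin (Nat.card I + 1)) Γ(T, ⊤)) :
    letI : Algebra intU.{u} Γ(T, ⊤) := (intCast _).toAlgebra
    frameLocus φ ≤ frameLocus (fun j => (isPullback_projToSpec_projMap_terminal I Γ(T, ⊤)).lift T.toSpecΓ (φ j)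
      (terminal.hom_ext _ _) ≫ actCore I M) := by
  letI : Algebra intU.{u} Γ(T, ⊤) := (intCast _).toAlgebra
  intro t ht
  rw [mem_frameLocus_iff_fromSpecResidueField] at ht ⊢
  letI : Algebra intU.{u} Γ(Spec (T.residueField t), ⊤) := (intCast _).toAlgebra
  have e : (fun j => T.fromSpecResidueField t ≫ ((isPullback_projToSpec_projMap_terminal I Γ(T, ⊤)).lift
      T.toSpecΓ (φ j) (terminal.hom_ext _ _) ≫ actCore I M)) =
      fun j => (isPullback_projToSpec_projMap_terminal I Γ(Spec (T.residueField t), ⊤)).lift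
        (Spec (T.residueField t)).toSpecΓ (T.fromSpecResidueField t ≫ φ j) (terminal.hom_ext _ _) ≫
        actCore I (Matrix.GeneralLinearGroup.map (T.fromSpecResidueField t).appTop.hom M) :=
    funext fun j => comp_lift_actCore I (T.fromSpecResidueField t) (φ j) M
  rw [e]
  exact frameLocus_lift_actCore_eq_top I (isUnit_of_ne_zero_ΓSpec_residueField t) _ _ ht

/-- **THE FRAME LOCUS IS `GL_{n+1}(Γ(T, 𝒪_T))`-INVARIANT: `frameLocus (fun j => M • φ j) = frameLocus φ`** for every
scheme `T`, every `(n+2)`-tuple of `T`-valued points of `𝐏ⁿ_ℤ` and every `M ∈ GL_{n+1}(Γ(T, 𝒪_T))` (MFK Prop. 3.1: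
«`U_R` is a `PGL(n+1)`-stable open set»; the other inclusion is the first one for `M⁻¹`, since `M⁻¹ • (M • q) = q`).
[cite: MumfordFogartyKirwan1994, Ch. 3 Proposition 3.1] -/
theorem frameLocus_lift_actCore (φ : Fin (Nat.card I + 2) → (T ⟶ projectiveSpaceInt I))
    (M : GL (Fin (Nat.card I + 1)) Γ(T, ⊤)) :
    letI : Algebra intU.{u} Γ(T, ⊤) := (intCast _).toAlgebra
    frameLocus (fun j => (isPullback_projToSpec_projMap_terminal I Γ(T, ⊤)).lift T.toSpecΓ (φ j)
      (terminal.hom_ext _ _) ≫ actCore I M) = frameLocus φ := by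
  letI : Algebra intU.{u} Γ(T, ⊤) := (intCast _).toAlgebra
  refine le_antisymm ?_ (frameLocus_le_frameLocus_lift_actCore I φ M)
  have h := frameLocus_le_frameLocus_lift_actCore I
    (fun j => (isPullback_projToSpec_projMap_terminal I Γ(T, ⊤)).lift T.toSpecΓ (φ j)
      (terminal.hom_ext _ _) ≫ actCore I M) M⁻¹
  have e : (fun j => (isPullback_projToSpec_projMap_terminal I Γ(T, ⊤)).lift T.toSpecΓ
      ((isPullback_projToSpec_projMap_terminal I Γ(T, ⊤)).lift T.toSpecΓ (φ j) (terminal.hom_ext _ _) ≫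
        actCore I M) (terminal.hom_ext _ _) ≫ actCore I M⁻¹) = φ :=
    funext fun j => lift_lift_actCore_inv I (φ j) M
  rwa [e] at h

end Literature.AlgebraicGeometry.Morphisms.ProjFrame
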